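import Summits.Ventures.FusionMHD.Bench.SolovevPCFIterQedgeClosedForm
import Summits.Ventures.FusionMHD.Bench.SolovevPCFNstxQedge
import HarnessLib

/-!
# F1 / QEDGE — the certified edge safety factor of the NSTX-like PCF Solov'ev equilibrium IS the printed
# CHEASE/Lee–Cerfon closed form `(2q₀/π)(R₀³/(R_min² R_max)) E(k)` (exact kernel identity)
(venture LADDER-GRIDFUSION, rung F1.a; cell `gridfusion`, seat `gridfusion-lit-4`, 2026-08-26; the NSTX-like twin of
`Bench/SolovevPCFIterQedgeClosedForm.lean`, whose §1 generic lemmas (`SolovevPCFIter.integral_desingularised_eq`: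
the de-singularising substitutions of §0 undone by Mathlib's monotone one-dimensional change of variables, then
Lee–Cerfon (q4) via `Solovev.integral_qLC_kernel`) are reused here.)

Instance of record (NSTX-like PCF shape `(ε, κ, δ) = (39/50, 2, 7/20)`; edge midplane radii `a = 1 − ε = 11/50`,
`b = 1 + ε = 89/50`; `ρ = (b² − a²)/2 = 39/25`, `u₀ = R_a² = 4021/2500`, `k² = 1 − a²/b² = 7800/7921`, all exact):
`edgeI_eq_ellipticE` (`edgeI = 2E(k)/(a²b)`), **`qEdgeOverF_eq_ellipticE`** (`qEdgeOverF = E(k)/(2π√K a²b)`),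
**`qEdgeOverF_eq_qLC`** (`qEdgeOverF = qLC (q₀/F) R_a a b` = the printed (q4) [cite: LeeCerfon2015, §4.1 eq. (q4)]
with `q₀ ↦ q₀/F = √r`, `R₀ ↦ R_a = √(4021/2500)`, via the exact identity `16·r·K·u₀³ = 1`), `ellipticE_bounds`
(the Bench's certified enclosure of `edgeI` encloses `E(√(7800/7921))`).

HONEST FRAMING (three columns). CERTIFIED: kernel identities/inequalities about the typed reals `edgeI`, `qEdgeOverF`
(sos-6, `SolovevPCFNstxQedge`) and the typed functionals `ellipticE`, `qLC` (Literature `SolovevCheaseFamily`): the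
enclosed number IS the printed closed form (q4) on the instance of record. MODELLED: as in `SolovevPCFNstxQedge`
(identification of `F·qEdgeOverF` with the MHD safety factor, Freidberg (6.35), of the edge surface of an ideal-MHD
Solov'ev-profile analytic fixed-boundary equilibrium); nothing here says any plasma or device is stable.
VALIDATED: nothing. No `native_decide`.
-/

noncomputable section

open Real MeasureTheory Set intervalIntegral
open Literature.MathematicalPhysics.MHD.Solovev (ellipticE qLC)
open Literature.Analysis.ValidatedNumerics.ExpPoly (Poly)

namespace Summit.Ventures.FusionMHD.Bench.SolovevPCFNstx

/-- `Poly.eval [2] w = 2`. [folklore] -/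
private theorem eval_two (w : ℝ) : Poly.eval [2] w = 2 := by
  simp only [Poly.eval_cons, Poly.eval_nil]; push_cast; ring

/-- `U₊(w) = b² − ρw²` with `b = 89/50`, `ρ = 39/25`. [folklore] -/
theorem Uplus_eq (w : ℝ) :
    Uplus w = (89 / 50 : ℝ) ^ 2 - ((89 / 50 : ℝ) ^ 2 - (11 / 50) ^ 2) / 2 * w ^ 2 := by
  unfold Uplus; push_cast; ring

/-- `U₋(w) = a² + ρw²` with `a = 11/50`, `ρ = 39/25`. [folklore] -/
theorem Uminus_eq (w : ℝ) :
    Uminus w = (11 / 50 : ℝ) ^ 2 + ((89 / 50 : ℝ) ^ 2 - (11 / 50) ^ 2) / 2 * w ^ 2 := by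
  unfold Uminus; push_cast; ring

/-- **`edgeI` is twice the singular midplane flux integral of Lee–Cerfon (q4) (line 2) for the edge surface
of the NSTX-like PCF instance** (`R_min = 11/50`, `R_max = 89/50`). [cite: LeeCerfon2015, §4.1 eq. (q4)] -/
theorem edgeI_eq_two_mul_integral :
    edgeI = 2 * ∫ R in (11 / 50 : ℝ)..(89 / 50),
      1 / (R ^ 2 * Real.sqrt ((R ^ 2 - (11 / 50) ^ 2) * ((89 / 50) ^ 2 - R ^ 2))) := by
  have ha : (0 : ℝ) < 11 / 50 := by norm_num
  have hab : (11 / 50 : ℝ) < 89 / 50 := by norm_num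
  obtain ⟨h1, -⟩ := SolovevPCFIter.integral_desingularised_eq ha hab
  rw [← h1, ← intervalIntegral.integral_const_mul]
  unfold edgeI
  refine intervalIntegral.integral_congr fun w _ => ?_
  rw [toFun_edgeIntegrand, eval_two, Uplus_eq, Uminus_eq]
  ring

/-- **`edgeI = 2·E(k)/(a²b)`**, `k = √(7800/7921)`, `a = 11/50`, `b = 89/50`.
[cite: LeeCerfon2015, §4.1 eq. (q4)] -/
theorem edgeI_eq_ellipticE :
    edgeI = 2 * (ellipticE (Real.sqrt (7800 / 7921)) / ((11 / 50 : ℝ) ^ 2 * (89 / 50))) := by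
  have ha : (0 : ℝ) < 11 / 50 := by norm_num
  have hab : (11 / 50 : ℝ) < 89 / 50 := by norm_num
  rw [edgeI_eq_two_mul_integral, (SolovevPCFIter.integral_desingularised_eq ha hab).2,
    show (1 : ℝ) - (11 / 50) ^ 2 / (89 / 50) ^ 2 = 7800 / 7921 by norm_num]

/-- **Kernel-checked enclosure of `E(√(7800/7921)) = edgeI·(a²b)/2`** from the Bench's certified enclosure
of `edgeI` (by-product). [folklore] -/
theorem ellipticE_bounds :
    ((28706068374649365869298707/1208925819614629174706176 : ℚ) : ℝ) * ((11 / 50 : ℝ) ^ 2 * (89 / 50) / 2)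
        ≤ ellipticE (Real.sqrt (7800 / 7921)) ∧
      ellipticE (Real.sqrt (7800 / 7921))
        ≤ ((28706068374650790224872365/1208925819614629174706176 : ℚ) : ℝ)
          * ((11 / 50 : ℝ) ^ 2 * (89 / 50) / 2) := by
  obtain ⟨hlo, hhi⟩ := edgeI_bounds
  have hE : ellipticE (Real.sqrt (7800 / 7921)) = edgeI * ((11 / 50 : ℝ) ^ 2 * (89 / 50) / 2) := by
    rw [edgeI_eq_ellipticE]; field_simp
  rw [hE]
  constructor
  · exact mul_le_mul_of_nonneg_right hlo (by norm_num)
  · exact mul_le_mul_of_nonneg_right hhi (by norm_num)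

/-- **The certified edge safety factor per unit `F` equals `E(k)/(2π√K·a²b)`** (`K = Kconst`, `k² = 7800/7921`,
`a = 11/50`, `b = 89/50`) — exact kernel identity. [cite: LeeCerfon2015, §4.1 eq. (q4)] -/
theorem qEdgeOverF_eq_ellipticE :
    qEdgeOverF = ellipticE (Real.sqrt (7800 / 7921))
      / (2 * π * Real.sqrt (Kconst : ℝ) * ((11 / 50 : ℝ) ^ 2 * (89 / 50))) := by
  have hK : 0 < Real.sqrt (Kconst : ℝ) := Real.sqrt_pos.2 (by simp only [Kconst]; push_cast; norm_num)
  unfold qEdgeOverF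
  rw [edgeI_eq_ellipticE]
  field_simp
  ring

/-- The exact rational identity `16·r·K·u₀³ = 1` (`r = (q₀/F)²`, `K = Kconst`, `u₀ = R_a² = 4021/2500`).
[folklore] -/
theorem sixteen_mul_q0OverFSq_mul_Kconst :
    (16 : ℝ) * (q0OverFSq : ℝ) * (Kconst : ℝ) * (4021 / 2500) ^ 3 = 1 := by
  simp only [q0OverFSq, Kconst]; push_cast; norm_num

/-- **The certified number IS the printed closed form (q4) on the instance of record:**
`qEdgeOverF = qLC (q₀/F) R_a R_min R_max` with `q₀/F = √r`, `R_a = √(4021/2500)`, `R_min = 11/50`,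
`R_max = 89/50` — i.e. `q_edge/F = (2(q₀/F)/π)(R_a³/(R_min² R_max)) E(k)`.
[cite: LeeCerfon2015, §4.1 eq. (q4)] -/
theorem qEdgeOverF_eq_qLC :
    qEdgeOverF = qLC (Real.sqrt (q0OverFSq : ℝ)) (Real.sqrt (4021 / 2500)) (11 / 50) (89 / 50) := by
  have hr0 : 0 < (q0OverFSq : ℝ) := by simp only [q0OverFSq]; push_cast; norm_num
  have hK0 : 0 < (Kconst : ℝ) := by simp only [Kconst]; push_cast; norm_num
  have hr : 0 < Real.sqrt (q0OverFSq : ℝ) := Real.sqrt_pos.2 hr0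
  have hK : 0 < Real.sqrt (Kconst : ℝ) := Real.sqrt_pos.2 hK0
  have hu : 0 < Real.sqrt (4021 / 2500 : ℝ) := Real.sqrt_pos.2 (by norm_num)
  set x : ℝ := 4 * Real.sqrt (q0OverFSq : ℝ) * Real.sqrt (Kconst : ℝ) * Real.sqrt (4021 / 2500) ^ 3
    with hx
  have hxpos : 0 < x := by positivity
  have hx2 : x ^ 2 = 1 := by
    have h3 : (Real.sqrt (4021 / 2500 : ℝ) ^ 3) ^ 2 = (4021 / 2500 : ℝ) ^ 3 := by
      rw [← pow_mul, show 3 * 2 = 2 * 3 from rfl, pow_mul, Real.sq_sqrt (by norm_num)]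
    calc x ^ 2 = 16 * Real.sqrt (q0OverFSq : ℝ) ^ 2 * Real.sqrt (Kconst : ℝ) ^ 2
          * (Real.sqrt (4021 / 2500 : ℝ) ^ 3) ^ 2 := by rw [hx]; ring
      _ = 16 * (q0OverFSq : ℝ) * (Kconst : ℝ) * (4021 / 2500) ^ 3 := by
          rw [Real.sq_sqrt hr0.le, Real.sq_sqrt hK0.le, h3]
      _ = 1 := sixteen_mul_q0OverFSq_mul_Kconst
  have hx1 : x = 1 := by nlinarith
  have hKinv : Real.sqrt (Kconst : ℝ)
      = 1 / (4 * Real.sqrt (q0OverFSq : ℝ) * Real.sqrt (4021 / 2500) ^ 3) := by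
    rw [eq_div_iff (by positivity)]
    rw [hx] at hx1
    linear_combination hx1
  rw [qEdgeOverF_eq_ellipticE, hKinv]
  unfold qLC
  rw [show (1 : ℝ) - (11 / 50) ^ 2 / (89 / 50) ^ 2 = 7800 / 7921 by norm_num]
  field_simp
  ring

end Summit.Ventures.FusionMHD.Bench.SolovevPCFNstx
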